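import Summits.AtomisticToContinuum.Crystallization.Theses.PricedLinkCensus
import Literature.Geometry.DiscreteGeometry.FejesTothKissingTwelve
import Summits.AtomisticToContinuum.Crystallization.Theorems.PricedLinkCensusSoftLayerPropagationStubChartAssembly
import Summits.AtomisticToContinuum.Crystallization.Theorems.PricedLinkCensusSoftLayerPropagationStubLinkEdges
import Summits.AtomisticToContinuum.Crystallization.Theorems.PricedLinkCensusSoftLayerPropagationStubDevelopHO
import Summits.AtomisticToContinuum.Crystallization.Theorems.PricedLinkCensusSoftLayerPropagationStubDevelopHXFcc
import Summits.AtomisticToContinuum.Crystallization.Theorems.PricedLinkCensusSoftLayerPropagationStubDevelopHXHcp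
import Summits.AtomisticToContinuum.Crystallization.Theorems.PricedLinkCensusSoftLayerPropagationDevelopRestReduction
import Summits.AtomisticToContinuum.Crystallization.Theorems.PricedLinkCensusSoftLayerPropagationStubDevelopH1R
import Summits.AtomisticToContinuum.Crystallization.Theorems.PricedLinkCensusSoftLayerPropagationStubSoftLinkTammes
import Summits.AtomisticToContinuum.Crystallization.Theorems.PricedLinkCensusSoftLayerPropagationStubDevelopReach

/-!
# Skeleton — crux `PricedLinkCensus.SoftLayerPropagation` (stmt-AtomisticToContinuum-14233),
# line `moebius-split` (crux-strategist s2 ALTERNATIVE line, 2026-08-17; live line: `Sketch` v7, lead c3)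

## Idea

Keep everything of `Sketch` v7 (charts; the LANDED exact development `stub_develop`; the map-based
η = 0 engine `stub_oneStackingMap` at shadow radius `33/10`; `stub_realBall`) — shared VERBATIM — and
re-type its one XL stub, the tracking theorem `stub_licence` (truth `≈ 0.08–0.09·nn` against the asked
`nn/6 = 0.1667·nn` at shadow radius `33/10`: factor `< 2`, certified-numerics class), along the STRUCTURE of
its extremisers.  Charge-free configurations are, to first order in `η`, conformal (Liouville: the
`10`-dimensional Möbius algebra) composed with a free trace-less strain of size `≈ η/3` riding in the
directions the conformal spread leaves idle; the worst legitimate deformation is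
(similarity) ∘ (special-conformal `c`, `‖c‖ ≈ 0.7η/nn`) ∘ (uniaxial strain `≈ η/3`) with the comparison
scale pinned to the centre's SHORTEST bond (`−η/3`).  So the licence is split into

* `stub_caProximity` (OPEN, the new stub; LP-certifiable with slack): the developed sites of the shadow
  `33/10`-ball are `δ₁·nn_i`-close to the image of their shadow points under ONE explicit
  conformal–affine polynomial map `x ↦ x + λx + Sx + 2⟪c,x⟫x − ‖x‖²c` (placed by a rigid motion and
  scaled by `nn_i`), with certified parameter bounds `‖c‖ ≤ Cmax`, `|λ| ≤ Lmax`, `‖S‖ ≤ Emax`;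
* `caDeviation_le` (PROVED below, pure algebra): such a map deviates from a translate of the identity
  by at most `δ₂ := Cmax·(33/10)² + (Lmax + Emax)·(33/10)` on the `33/10`-ball, using the exact identity
  `‖2⟪c,x⟫x − ‖x‖²c‖ = ‖c‖·‖x‖²`;
* `licence_of_ca` (PROVED below): `δ₁ + δ₂ ≤ 1/6` gives back exactly the conclusion of
  `Sketch.stub_licence`, and the v7 glue closes the crux.

Why this dodges the stuck goal: the direct rigid-gauge certificate must beat a factor `≈ 1.3–1.5`
(linear value `LP₁ ≈ 9.5–13·η` at `33/10` against the budget `16.67·η`, with a rotation² linearisation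
remainder of `20–60 %` on the outer constraints); in the split, the Möbius part — `≈ 80 %` of the
deviation — is carried by three BULK parameters whose certified ranges have negligible remainder, the
rotation² remainder itself becomes EXPLICIT (it is dominated by the known conformal–affine part), and
only the small non-conformal residual `δ₁` needs a sup-norm LP certificate.  Numbers: strategist kit jobs
j026729 (rigid gauge: `LP₁` by labelled region × radius, boxed-remainder pass, nonlinear realisation of
the extremal) and j026736 (conformal–affine gauge: residual `V₁′`, parameter ranges) — see
`Lines/moebius-split.md` and `STRATEGY-CENSUS.md` (s2).

Disproof used (Cruxes/SoftLayerPropagation/Disproof.lean v5): `softLayerPropagation_false_without_ball` /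
`_radius_threeHalves` / `_radius_one` — honoured (development, engine and the proximity LP consume
charge-freeness out to the graph `5`-ball and charts to `8·nn_i`); `softLayerPropagation_tolerance_lb`
(`¬ SLP 8 3 (1/20)`: the `1.99 %` strain family) — honoured: that family IS a point of the
conformal–affine family (`c = 0`, `S` uniaxial), its deviation `0.056·nn` is booked in `δ₂`, not in the
residual; `softLayerPropagation_false_radius_twin` (`¬ SLP (14/5) 3 (1/6)`) — the engine stub is v7's,
built on exactly this family.  No stub is an instance of a landed Negative lemma (none landed).
-/

noncomputable section

namespace Summit.AtomisticToContinuum.Crystallization.Cruxes.SoftLayerPropagation.MoebiusSplit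

open Literature.Geometry.DiscreteGeometry Literature.MathematicalPhysics.StatisticalMechanics
open scoped InnerProductSpace

/-- Euclidean `3`-space. -/
abbrev E3 : Type := EuclideanSpace ℝ (Fin 3)

/-! ## The registered stubs (`sorry` only in the OPEN ones; signatures fully inlined)

LANDED: `stub_chartAssembly` (p87977), `stub_linkEdges` (p90764), `develop_HO` (p126443), `develop_HX_fcc`
(p130655), `develop_HX_hcp` (p133351), `develop_rest` (p135147 ∘ `develop_H1R` p146307) — their bodies below
are the tree theorems.  OPEN: `stub_softLink` (conditional landed), `stub_oneStackingMap`,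
`stub_realBall`, `stub_licence`. -/

/-- **stub_softLink** (13 points, analytic; CONDITIONAL VERSION LANDED p127877: `Theorems.stub_softLink_of_tammes13 :
musinTarasov2012_tammes_thirteen → stub_softLink` — the named Literature fact (Tammes `N = 13`, Musin–Tarasov 2012) is the only
open debt of item 14234; = `H` of `Theorems.softFourRings_of_twelve_unit`,
item `SoftFourRings` 14234 in twelve-point form).  Twelve points `z j` with `1 ≤ ‖z j‖ ≤ (1+η) min 1 (n j)`,
`n j ≤ ‖z j‖`, `n j ≤ dist (z j) (z k)` (`j ≠ k`) and soft link `4`-regular: some rotated FCC/HCP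
pattern has every point within `1/4` of some `z j`. -/
theorem stub_softLink : ∀ η : ℝ, 0 < η → η ≤ 1 / 100 →
      ∀ (z : Fin 12 → EuclideanSpace ℝ (Fin 3)) (n : Fin 12 → ℝ),
        (∀ j, 1 ≤ ‖z j‖) →
        (∀ j, ‖z j‖ ≤ (1 + η) * min 1 (n j)) →
        (∀ j, n j ≤ ‖z j‖) →
        (∀ j k, j ≠ k → n j ≤ dist (z j) (z k)) →
        (∀ j, (Finset.univ.filter (fun k : Fin 12 =>
            k ≠ j ∧ dist (z j) (z k) ≤ (1 + η) * min (n j) (n k))).card = 4) →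
        ∃ (A : EuclideanSpace ℝ (Fin 3) →ₗᵢ[ℝ] EuclideanSpace ℝ (Fin 3))
          (P : Finset (EuclideanSpace ℝ (Fin 3))),
          (P = Literature.Geometry.DiscreteGeometry.fccKissingPattern ∨
            P = Literature.Geometry.DiscreteGeometry.hcpKissingPattern) ∧
            ∀ p ∈ P, ∃ j : Fin 12, dist (z j) (A p) ≤ 1 / 4 := by
  sorry

/-- **stub_linkEdges** (13 points, analytic).  In the situation of `stub_softLink`, once a rotated
pattern `A P` is `1/4`-matched to the twelve points, two BONDED points are matched to pattern
points at distance exactly `1` (pattern-adjacent): no bond of the soft link runs along a square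
diagonal (`√2`) of the pattern (all longer pattern distances are excluded by the triangle
inequality alone). -/
theorem stub_linkEdges : ∀ η : ℝ, 0 < η → η ≤ 1 / 100 →
      ∀ (z : Fin 12 → EuclideanSpace ℝ (Fin 3)) (n : Fin 12 → ℝ),
        (∀ j, 1 ≤ ‖z j‖) →
        (∀ j, ‖z j‖ ≤ (1 + η) * min 1 (n j)) →
        (∀ j, n j ≤ ‖z j‖) →
        (∀ j k, j ≠ k → n j ≤ dist (z j) (z k)) →
        (∀ j, (Finset.univ.filter (fun k : Fin 12 =>
            k ≠ j ∧ dist (z j) (z k) ≤ (1 + η) * min (n j) (n k))).card = 4) →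
        ∀ (A : EuclideanSpace ℝ (Fin 3) →ₗᵢ[ℝ] EuclideanSpace ℝ (Fin 3))
          (P : Finset (EuclideanSpace ℝ (Fin 3))),
          (P = Literature.Geometry.DiscreteGeometry.fccKissingPattern ∨
            P = Literature.Geometry.DiscreteGeometry.hcpKissingPattern) →
          (∀ p ∈ P, ∃ j : Fin 12, dist (z j) (A p) ≤ 1 / 4) →
          ∀ p ∈ P, ∀ q ∈ P, ∀ j k : Fin 12,
            dist (z j) (A p) ≤ 1 / 4 → dist (z k) (A q) ≤ 1 / 4 → j ≠ k →
            dist (z j) (z k) ≤ (1 + η) * min (n j) (n k) → dist p q = 1 := by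
  exact Summit.AtomisticToContinuum.Crystallization.Theorems.stub_linkEdges

/-- **stub_chartAssembly** (bookkeeping).  The two twelve-point statements give, at every
charge-free site `j` of positive scale, an exact labelled CHART: a pattern `P` (FCC or HCP), a
linear isometry `A` and labels `m : pattern point ↦ site` with `m p` a bond-neighbour of `j` within
`nn_j/4` of `y j + nn_j • A p`, `m` injective on `P`, bonds between labelled sites exactly the
pattern contacts (`dist p q = 1`), and every bond-neighbour of `j` labelled.  (Enumerate the twelve
neighbours, normalise `y j = 0`, `nn_j = 1` as in `Theorems.softFourRings_of_twelve(_unit)`;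
injectivity since pattern points are `≥ 1` apart and `1/4 + 1/4 < 1 ≤` the separation of sites;
`→` of the graph isomorphism is `stub_linkEdges`, `←` and surjectivity by counting degrees `4`/`12`.) -/
theorem stub_chartAssembly :
    (∀ η : ℝ, 0 < η → η ≤ 1 / 100 →
      ∀ (z : Fin 12 → EuclideanSpace ℝ (Fin 3)) (n : Fin 12 → ℝ),
        (∀ j, 1 ≤ ‖z j‖) →
        (∀ j, ‖z j‖ ≤ (1 + η) * min 1 (n j)) →
        (∀ j, n j ≤ ‖z j‖) →
        (∀ j k, j ≠ k → n j ≤ dist (z j) (z k)) →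
        (∀ j, (Finset.univ.filter (fun k : Fin 12 =>
            k ≠ j ∧ dist (z j) (z k) ≤ (1 + η) * min (n j) (n k))).card = 4) →
        ∃ (A : EuclideanSpace ℝ (Fin 3) →ₗᵢ[ℝ] EuclideanSpace ℝ (Fin 3))
          (P : Finset (EuclideanSpace ℝ (Fin 3))),
          (P = Literature.Geometry.DiscreteGeometry.fccKissingPattern ∨
            P = Literature.Geometry.DiscreteGeometry.hcpKissingPattern) ∧
            ∀ p ∈ P, ∃ j : Fin 12, dist (z j) (A p) ≤ 1 / 4) →
    (∀ η : ℝ, 0 < η → η ≤ 1 / 100 →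
      ∀ (z : Fin 12 → EuclideanSpace ℝ (Fin 3)) (n : Fin 12 → ℝ),
        (∀ j, 1 ≤ ‖z j‖) →
        (∀ j, ‖z j‖ ≤ (1 + η) * min 1 (n j)) →
        (∀ j, n j ≤ ‖z j‖) →
        (∀ j k, j ≠ k → n j ≤ dist (z j) (z k)) →
        (∀ j, (Finset.univ.filter (fun k : Fin 12 =>
            k ≠ j ∧ dist (z j) (z k) ≤ (1 + η) * min (n j) (n k))).card = 4) →
        ∀ (A : EuclideanSpace ℝ (Fin 3) →ₗᵢ[ℝ] EuclideanSpace ℝ (Fin 3))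
          (P : Finset (EuclideanSpace ℝ (Fin 3))),
          (P = Literature.Geometry.DiscreteGeometry.fccKissingPattern ∨
            P = Literature.Geometry.DiscreteGeometry.hcpKissingPattern) →
          (∀ p ∈ P, ∃ j : Fin 12, dist (z j) (A p) ≤ 1 / 4) →
          ∀ p ∈ P, ∀ q ∈ P, ∀ j k : Fin 12,
            dist (z j) (A p) ≤ 1 / 4 → dist (z k) (A q) ≤ 1 / 4 → j ≠ k →
            dist (z j) (z k) ≤ (1 + η) * min (n j) (n k) → dist p q = 1) →
    ∀ η : ℝ, 0 < η → η ≤ 1 / 100 →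
      ∀ (N : ℕ) (y : Fin N → EuclideanSpace ℝ (Fin 3)) (j : Fin N),
        Literature.Geometry.DiscreteGeometry.IsChargeFree η y j →
        0 < Literature.Geometry.DiscreteGeometry.nearestDist y j →
        ∃ (P : Finset (EuclideanSpace ℝ (Fin 3)))
          (A : EuclideanSpace ℝ (Fin 3) →ₗᵢ[ℝ] EuclideanSpace ℝ (Fin 3))
          (m : EuclideanSpace ℝ (Fin 3) → Fin N),
          (P = Literature.Geometry.DiscreteGeometry.fccKissingPattern ∨
            P = Literature.Geometry.DiscreteGeometry.hcpKissingPattern) ∧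
          (∀ p ∈ P, (Literature.Geometry.DiscreteGeometry.bondGraph η y).Adj j (m p) ∧
            dist (y (m p)) (y j + Literature.Geometry.DiscreteGeometry.nearestDist y j • A p) ≤
              Literature.Geometry.DiscreteGeometry.nearestDist y j / 4) ∧
          (∀ p ∈ P, ∀ q ∈ P, m p = m q → p = q) ∧
          (∀ p ∈ P, ∀ q ∈ P,
            ((Literature.Geometry.DiscreteGeometry.bondGraph η y).Adj (m p) (m q) ↔ dist p q = 1)) ∧
          (∀ k, (Literature.Geometry.DiscreteGeometry.bondGraph η y).Adj j k → ∃ p ∈ P, m p = k) := by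
  exact Summit.AtomisticToContinuum.Crystallization.Theorems.stub_chartAssembly

/-- **develop_HO** (registered stub; LANDED p126443 as `Theorems.develop_HO`; handedness through gauge-fixed charts).  From the charts of
`stub_chartAssembly` on the `8·nn_i`-ball one can CHOOSE chart functions `Pc, Ac, mc` (same
specification) such that for every bond `j ∼ k` of charted sites and every contact tetrahedron
`{j, k, a, b}` through it, the signed volume of the labels of `(k, a, b)` at `j` is MINUS that of the
labels of `(j, a, b)` at `k`.  Route: gauge-fix every chart to `det = +1` by precomposing with the
pattern's improper symmetry (`−id` for FCC, the reflection in the hexagonal plane `x+y+z=0` for the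
tree's HCP coordinates), then `Theorems.metric_handedness_chart` at both ends (`δ = 1/20` covers the
bond windows `[1/1.01, 1.0201]`), `det (−w₁, w₂−w₁, w₃−w₁) = −det (w₁, w₂, w₃)`, and
`|det| = 1/√2` for exact contact triples (`det3_sq_eq_half_of_contact`). -/
theorem develop_HO :
    ∀ η : ℝ, 0 < η → η ≤ 1 / 100 →
      ∀ (N : ℕ) (y : Fin N → EuclideanSpace ℝ (Fin 3)) (i : Fin N),
        0 < Literature.Geometry.DiscreteGeometry.nearestDist y i →
        (∀ j : Fin N, dist (y i) (y j) ≤ 8 * Literature.Geometry.DiscreteGeometry.nearestDist y i →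
          Literature.Geometry.DiscreteGeometry.IsChargeFree η y j) →
        (∀ j : Fin N, dist (y i) (y j) ≤ 8 * Literature.Geometry.DiscreteGeometry.nearestDist y i →
          ∃ (P : Finset (EuclideanSpace ℝ (Fin 3)))
            (A : EuclideanSpace ℝ (Fin 3) →ₗᵢ[ℝ] EuclideanSpace ℝ (Fin 3))
            (m : EuclideanSpace ℝ (Fin 3) → Fin N),
            (P = Literature.Geometry.DiscreteGeometry.fccKissingPattern ∨
              P = Literature.Geometry.DiscreteGeometry.hcpKissingPattern) ∧
            (∀ p ∈ P, (Literature.Geometry.DiscreteGeometry.bondGraph η y).Adj j (m p) ∧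
              dist (y (m p)) (y j + Literature.Geometry.DiscreteGeometry.nearestDist y j • A p) ≤
                Literature.Geometry.DiscreteGeometry.nearestDist y j / 4) ∧
            (∀ p ∈ P, ∀ q ∈ P, m p = m q → p = q) ∧
            (∀ p ∈ P, ∀ q ∈ P,
              ((Literature.Geometry.DiscreteGeometry.bondGraph η y).Adj (m p) (m q) ↔ dist p q = 1)) ∧
            (∀ l, (Literature.Geometry.DiscreteGeometry.bondGraph η y).Adj j l → ∃ p ∈ P, m p = l)) →
        ∃ (Pc : Fin N → Finset (EuclideanSpace ℝ (Fin 3)))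
          (Ac : Fin N → EuclideanSpace ℝ (Fin 3) →ₗᵢ[ℝ] EuclideanSpace ℝ (Fin 3))
          (mc : Fin N → EuclideanSpace ℝ (Fin 3) → Fin N),
          (∀ j : Fin N, dist (y i) (y j) ≤ 8 * Literature.Geometry.DiscreteGeometry.nearestDist y i →
            (Pc j = Literature.Geometry.DiscreteGeometry.fccKissingPattern ∨
              Pc j = Literature.Geometry.DiscreteGeometry.hcpKissingPattern) ∧
            (∀ p ∈ Pc j, (Literature.Geometry.DiscreteGeometry.bondGraph η y).Adj j (mc j p) ∧
              dist (y (mc j p)) (y j + Literature.Geometry.DiscreteGeometry.nearestDist y j • Ac j p) ≤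
                Literature.Geometry.DiscreteGeometry.nearestDist y j / 4) ∧
            (∀ p ∈ Pc j, ∀ q ∈ Pc j, mc j p = mc j q → p = q) ∧
            (∀ p ∈ Pc j, ∀ q ∈ Pc j,
              ((Literature.Geometry.DiscreteGeometry.bondGraph η y).Adj (mc j p) (mc j q) ↔ dist p q = 1)) ∧
            (∀ l, (Literature.Geometry.DiscreteGeometry.bondGraph η y).Adj j l → ∃ p ∈ Pc j, mc j p = l)) ∧
          (∀ j k : Fin N, dist (y i) (y j) ≤ 8 * Literature.Geometry.DiscreteGeometry.nearestDist y i →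
            dist (y i) (y k) ≤ 8 * Literature.Geometry.DiscreteGeometry.nearestDist y i → (Literature.Geometry.DiscreteGeometry.bondGraph η y).Adj j k →
            ∀ a b : Fin N, (Literature.Geometry.DiscreteGeometry.bondGraph η y).Adj j a → (Literature.Geometry.DiscreteGeometry.bondGraph η y).Adj j b → (Literature.Geometry.DiscreteGeometry.bondGraph η y).Adj k a → (Literature.Geometry.DiscreteGeometry.bondGraph η y).Adj k b → (Literature.Geometry.DiscreteGeometry.bondGraph η y).Adj a b →
            ∀ p₁ ∈ Pc j, ∀ p₂ ∈ Pc j, ∀ p₃ ∈ Pc j, mc j p₁ = k → mc j p₂ = a → mc j p₃ = b →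
            ∀ q₁ ∈ Pc k, ∀ q₂ ∈ Pc k, ∀ q₃ ∈ Pc k, mc k q₁ = j → mc k q₂ = a → mc k q₃ = b →
            Matrix.det ![WithLp.ofLp p₁, WithLp.ofLp p₂, WithLp.ofLp p₃] =
              - Matrix.det ![WithLp.ofLp q₁, WithLp.ofLp q₂, WithLp.ofLp q₃]) := by
  exact Summit.AtomisticToContinuum.Crystallization.Theorems.develop_HO

/-- **develop_HX_fcc** (registered stub; LANDED p130655 as `Theorems.develop_HX_fcc`, worker of lead c2; LOCAL NO-MERGE at an FCC-type site = hypothesis `HX` of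
`Theorems.develop_step`).  `x` charge-free with an FCC chart, everything within `5/2·nn_x` charge-free
and charted; `u, k` non-bonded neighbours of `x`, `t ∉ star(x)` bonded to both ⇒ some `c` is bonded to
`x, u, k, t`.  Cases by the label distance of `u, k` in the chart of `x`: `2` (antipodal: the charts give
`‖y_u + y_k − 2 y_x‖ ≤ nn_x/2`, so a common neighbour of `u, k` is within `< nn` of `y_x`, i.e. is `x`);
`√2` (square diagonal: `Theorems.metric_octahedron(_apex)` pins the far apex `z` of the octahedron on the
square, the hard core `dist ≥ max nn` leaves only an arc of `≈ 1°` about `z` on the circle of common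
neighbours, so `t = z` and `c` = another corner of the square); `√3` (no such `t`: the two lattice
common neighbours are `x` and a neighbour of `x`, antipodal on a circle of diameter `nn`). -/
theorem develop_HX_fcc :
    ∀ η : ℝ, 0 < η → η ≤ 1 / 100 →
      ∀ (N : ℕ) (y : Fin N → EuclideanSpace ℝ (Fin 3)) (x : Fin N),
        0 < Literature.Geometry.DiscreteGeometry.nearestDist y x →
        (∀ j : Fin N, dist (y x) (y j) ≤ 5 / 2 * Literature.Geometry.DiscreteGeometry.nearestDist y x →
          Literature.Geometry.DiscreteGeometry.IsChargeFree η y j) →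
        (∀ j : Fin N, dist (y x) (y j) ≤ 5 / 2 * Literature.Geometry.DiscreteGeometry.nearestDist y x →
          ∃ (P : Finset (EuclideanSpace ℝ (Fin 3)))
            (A : EuclideanSpace ℝ (Fin 3) →ₗᵢ[ℝ] EuclideanSpace ℝ (Fin 3))
            (m : EuclideanSpace ℝ (Fin 3) → Fin N),
            (P = Literature.Geometry.DiscreteGeometry.fccKissingPattern ∨
              P = Literature.Geometry.DiscreteGeometry.hcpKissingPattern) ∧
            (∀ p ∈ P, (Literature.Geometry.DiscreteGeometry.bondGraph η y).Adj j (m p) ∧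
              dist (y (m p)) (y j + Literature.Geometry.DiscreteGeometry.nearestDist y j • A p) ≤
                Literature.Geometry.DiscreteGeometry.nearestDist y j / 4) ∧
            (∀ p ∈ P, ∀ q ∈ P, m p = m q → p = q) ∧
            (∀ p ∈ P, ∀ q ∈ P,
              ((Literature.Geometry.DiscreteGeometry.bondGraph η y).Adj (m p) (m q) ↔ dist p q = 1)) ∧
            (∀ l, (Literature.Geometry.DiscreteGeometry.bondGraph η y).Adj j l → ∃ p ∈ P, m p = l)) →
        ∀ (A : EuclideanSpace ℝ (Fin 3) →ₗᵢ[ℝ] EuclideanSpace ℝ (Fin 3)) (m : EuclideanSpace ℝ (Fin 3) → Fin N),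
          ((Literature.Geometry.DiscreteGeometry.fccKissingPattern = Literature.Geometry.DiscreteGeometry.fccKissingPattern ∨
            Literature.Geometry.DiscreteGeometry.fccKissingPattern = Literature.Geometry.DiscreteGeometry.hcpKissingPattern) ∧
          (∀ p ∈ Literature.Geometry.DiscreteGeometry.fccKissingPattern, (Literature.Geometry.DiscreteGeometry.bondGraph η y).Adj x (m p) ∧
            dist (y (m p)) (y x + Literature.Geometry.DiscreteGeometry.nearestDist y x • A p) ≤
              Literature.Geometry.DiscreteGeometry.nearestDist y x / 4) ∧
          (∀ p ∈ Literature.Geometry.DiscreteGeometry.fccKissingPattern, ∀ q ∈ Literature.Geometry.DiscreteGeometry.fccKissingPattern, m p = m q → p = q) ∧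
          (∀ p ∈ Literature.Geometry.DiscreteGeometry.fccKissingPattern, ∀ q ∈ Literature.Geometry.DiscreteGeometry.fccKissingPattern,
            ((Literature.Geometry.DiscreteGeometry.bondGraph η y).Adj (m p) (m q) ↔ dist p q = 1)) ∧
          (∀ l, (Literature.Geometry.DiscreteGeometry.bondGraph η y).Adj x l → ∃ p ∈ Literature.Geometry.DiscreteGeometry.fccKissingPattern, m p = l)) →
        ∀ u k t : Fin N, (Literature.Geometry.DiscreteGeometry.bondGraph η y).Adj x u → (Literature.Geometry.DiscreteGeometry.bondGraph η y).Adj x k → ¬ (Literature.Geometry.DiscreteGeometry.bondGraph η y).Adj u k → u ≠ k →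
          ¬ (Literature.Geometry.DiscreteGeometry.bondGraph η y).Adj x t → x ≠ t → (Literature.Geometry.DiscreteGeometry.bondGraph η y).Adj t u → (Literature.Geometry.DiscreteGeometry.bondGraph η y).Adj t k →
          ∃ c : Fin N, (Literature.Geometry.DiscreteGeometry.bondGraph η y).Adj x c ∧ (Literature.Geometry.DiscreteGeometry.bondGraph η y).Adj u c ∧ (Literature.Geometry.DiscreteGeometry.bondGraph η y).Adj k c ∧ (Literature.Geometry.DiscreteGeometry.bondGraph η y).Adj t c := by
  exact Summit.AtomisticToContinuum.Crystallization.Theorems.develop_HX_fcc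

/-- **develop_HX_hcp** (registered stub; LANDED p133351 as `Theorems.develop_HX_hcp`, worker of lead c2; LOCAL NO-MERGE at an HCP-type site).  As `develop_HX_fcc`
with the anticuboctahedral label classes `√2, √(8/3), √3, √(11/3), 2` (`√(8/3)`: the vertical pair
through a triangle — `Theorems.metric_bipyramid(_unique)`). -/
theorem develop_HX_hcp :
    ∀ η : ℝ, 0 < η → η ≤ 1 / 100 →
      ∀ (N : ℕ) (y : Fin N → EuclideanSpace ℝ (Fin 3)) (x : Fin N),
        0 < Literature.Geometry.DiscreteGeometry.nearestDist y x →
        (∀ j : Fin N, dist (y x) (y j) ≤ 5 / 2 * Literature.Geometry.DiscreteGeometry.nearestDist y x →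
          Literature.Geometry.DiscreteGeometry.IsChargeFree η y j) →
        (∀ j : Fin N, dist (y x) (y j) ≤ 5 / 2 * Literature.Geometry.DiscreteGeometry.nearestDist y x →
          ∃ (P : Finset (EuclideanSpace ℝ (Fin 3)))
            (A : EuclideanSpace ℝ (Fin 3) →ₗᵢ[ℝ] EuclideanSpace ℝ (Fin 3))
            (m : EuclideanSpace ℝ (Fin 3) → Fin N),
            (P = Literature.Geometry.DiscreteGeometry.fccKissingPattern ∨
              P = Literature.Geometry.DiscreteGeometry.hcpKissingPattern) ∧
            (∀ p ∈ P, (Literature.Geometry.DiscreteGeometry.bondGraph η y).Adj j (m p) ∧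
              dist (y (m p)) (y j + Literature.Geometry.DiscreteGeometry.nearestDist y j • A p) ≤
                Literature.Geometry.DiscreteGeometry.nearestDist y j / 4) ∧
            (∀ p ∈ P, ∀ q ∈ P, m p = m q → p = q) ∧
            (∀ p ∈ P, ∀ q ∈ P,
              ((Literature.Geometry.DiscreteGeometry.bondGraph η y).Adj (m p) (m q) ↔ dist p q = 1)) ∧
            (∀ l, (Literature.Geometry.DiscreteGeometry.bondGraph η y).Adj j l → ∃ p ∈ P, m p = l)) →
        ∀ (A : EuclideanSpace ℝ (Fin 3) →ₗᵢ[ℝ] EuclideanSpace ℝ (Fin 3)) (m : EuclideanSpace ℝ (Fin 3) → Fin N),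
          ((Literature.Geometry.DiscreteGeometry.hcpKissingPattern = Literature.Geometry.DiscreteGeometry.fccKissingPattern ∨
            Literature.Geometry.DiscreteGeometry.hcpKissingPattern = Literature.Geometry.DiscreteGeometry.hcpKissingPattern) ∧
          (∀ p ∈ Literature.Geometry.DiscreteGeometry.hcpKissingPattern, (Literature.Geometry.DiscreteGeometry.bondGraph η y).Adj x (m p) ∧
            dist (y (m p)) (y x + Literature.Geometry.DiscreteGeometry.nearestDist y x • A p) ≤
              Literature.Geometry.DiscreteGeometry.nearestDist y x / 4) ∧
          (∀ p ∈ Literature.Geometry.DiscreteGeometry.hcpKissingPattern, ∀ q ∈ Literature.Geometry.DiscreteGeometry.hcpKissingPattern, m p = m q → p = q) ∧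
          (∀ p ∈ Literature.Geometry.DiscreteGeometry.hcpKissingPattern, ∀ q ∈ Literature.Geometry.DiscreteGeometry.hcpKissingPattern,
            ((Literature.Geometry.DiscreteGeometry.bondGraph η y).Adj (m p) (m q) ↔ dist p q = 1)) ∧
          (∀ l, (Literature.Geometry.DiscreteGeometry.bondGraph η y).Adj x l → ∃ p ∈ Literature.Geometry.DiscreteGeometry.hcpKissingPattern, m p = l)) →
        ∀ u k t : Fin N, (Literature.Geometry.DiscreteGeometry.bondGraph η y).Adj x u → (Literature.Geometry.DiscreteGeometry.bondGraph η y).Adj x k → ¬ (Literature.Geometry.DiscreteGeometry.bondGraph η y).Adj u k → u ≠ k →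
          ¬ (Literature.Geometry.DiscreteGeometry.bondGraph η y).Adj x t → x ≠ t → (Literature.Geometry.DiscreteGeometry.bondGraph η y).Adj t u → (Literature.Geometry.DiscreteGeometry.bondGraph η y).Adj t k →
          ∃ c : Fin N, (Literature.Geometry.DiscreteGeometry.bondGraph η y).Adj x c ∧ (Literature.Geometry.DiscreteGeometry.bondGraph η y).Adj u c ∧ (Literature.Geometry.DiscreteGeometry.bondGraph η y).Adj k c ∧ (Literature.Geometry.DiscreteGeometry.bondGraph η y).Adj t c := by
  exact Summit.AtomisticToContinuum.Crystallization.Theorems.develop_HX_hcp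

/-- **develop_H1R** (registered stub; LANDED p146307 as `Theorems.develop_H1R`, wave-3 worker of lead c2, 2026-08-17, with 44 helper files `…H1R*.lean`; v5: the last open piece of the development; the metric
ORDERED-CAPS lemma, hypothesis `H1R` of `Theorems.develop_rest_of_orderedCaps`, p135147).  At a site `u` with
`dist (y i) (y u) + (8/3) nn_u ≤ 8 nn_i` (so everything within `(8/3) nn_u` of `u` is charge-free and charted), if
`u ~ t ~ k`, `u ≁ k`, `u ≠ k`, and, measured from `y i`, `k` is not farther than `u` by more than `(11/200) nn_u` and
`t` is not nearer than `u` by more than `(3/100) nn_u`, then some bond-neighbour `c` of `u`, nearer to `y i` than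
`u` by MORE than `(3/100) nn_u`, is bonded to `t` or to `k`.  Numerics (worker of develop_rest): on ideal Barlow
clusters (8 Hägg words, 672 types `(t,k)`, observer in every direction at `0.95 ≤ r ≤ 6.6`) the best candidate among
the ring of `{u,t}` ∪ the common neighbours of `{u,k}` (∪ the far apex of the coned square for the `√2` types) is
nearer by `≥ 0.336 nn`; with premises relaxed by `ε = 0.05/0.10/0.15/0.20` the margin is `0.30/0.29/0.24/0.21`; so it
closes once the cluster `{u,t,k,candidates}` (diameter ≤ 2.1 nn) is pinned to `≲ 0.17 nn` per site up to a rigid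
motion — true deviations are `≈ 0.03–0.06 nn`, the landed octahedron identity gives `0.13–0.20 nn`: what is missing
is a sharper small-cluster rigidity lemma (tetrahedron-on-octahedron-face / rhombus flatness). -/
theorem develop_H1R : ∀ η : ℝ, 0 < η → η ≤ 1 / 100 → ∀ (N : ℕ) (y : Fin N → EuclideanSpace ℝ (Fin 3)) (i : Fin N), 0 < nearestDist y i → (∀ j : Fin N, dist (y i) (y j) ≤ 8 * nearestDist y i → IsChargeFree η y j) → (∀ j : Fin N, dist (y i) (y j) ≤ 8 * nearestDist y i → ∃ (P : Finset (EuclideanSpace ℝ (Fin 3))) (A : EuclideanSpace ℝ (Fin 3) →ₗᵢ[ℝ] EuclideanSpace ℝ (Fin 3)) (m : EuclideanSpace ℝ (Fin 3) → Fin N), (P = fccKissingPattern ∨ P = hcpKissingPattern) ∧ (∀ p ∈ P, (bondGraph η y).Adj j (m p) ∧ dist (y (m p)) (y j + nearestDist y j • A p) ≤ nearestDist y j / 4) ∧ (∀ p ∈ P, ∀ q ∈ P, m p = m q → p = q) ∧ (∀ p ∈ P, ∀ q ∈ P, ((bondGraph η y).Adj (m p) (m q) ↔ dist p q = 1)) ∧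 (∀ k, (bondGraph η y).Adj j k → ∃ p ∈ P, m p = k)) → ∀ u t k : Fin N, dist (y i) (y u) + 8 / 3 * nearestDist y u ≤ 8 * nearestDist y i → (bondGraph η y).Adj u t → (bondGraph η y).Adj t k → ¬ (bondGraph η y).Adj u k → u ≠ k → dist (y i) (y k) ≤ dist (y i) (y u) + 11 / 200 * nearestDist y u → dist (y i) (y u) ≤ dist (y i) (y t) + 3 / 100 * nearestDist y u → ∃ c : Fin N, (bondGraph η y).Adj u c ∧ dist (y i) (y c) + 3 / 100 * nearestDist y u < dist (y i) (y u) ∧ ((bondGraph η y).Adj c t ∨ (bondGraph η y).Adj c k) := by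
  exact Summit.AtomisticToContinuum.Crystallization.Theorems.develop_H1R

/-- **develop_rest** (registered stub; v5: PROVED from `develop_H1R` by `Theorems.develop_rest_of_orderedCaps`, p135147, with the
penalised radial potential `f v = dist (y i) (y v) + (8/3) max 0 (nn_v − (53/50) nn_i)`, `R₁ = (129/25) nn_i`, `R₂ = 8 nn_i`; the REMAINDER of the development after `develop_HO` and the two
no-merge lemmas): choose the gauge-fixed charts, take `f = dist (y i) ·`, `R₁ = 26/5·nn_i ⊇` the graph
`5`-ball (`Theorems.develop_reach`), `R₂ = 8 nn_i`; supply `hnbr` (scale coherence by a greedy walk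
through the charts: pattern covering radius `45°`), `H1` (ordered caps: lattice margin `≥ 0.21·nn` for
every observer direction up to `r = 6.6`, so it needs cluster precision `≲ 0.1·nn` — octahedron-level,
sharper than the bipyramid constant `5.2α`), derive `HX` in scope from the two local lemmas, and call
`Theorems.develop_reduction`. -/
theorem develop_rest :
    (∀ η : ℝ, 0 < η → η ≤ 1 / 100 →
      ∀ (N : ℕ) (y : Fin N → EuclideanSpace ℝ (Fin 3)) (i : Fin N),
        0 < Literature.Geometry.DiscreteGeometry.nearestDist y i →
        (∀ j : Fin N, dist (y i) (y j) ≤ 8 * Literature.Geometry.DiscreteGeometry.nearestDist y i →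
          Literature.Geometry.DiscreteGeometry.IsChargeFree η y j) →
        (∀ j : Fin N, dist (y i) (y j) ≤ 8 * Literature.Geometry.DiscreteGeometry.nearestDist y i →
          ∃ (P : Finset (EuclideanSpace ℝ (Fin 3)))
            (A : EuclideanSpace ℝ (Fin 3) →ₗᵢ[ℝ] EuclideanSpace ℝ (Fin 3))
            (m : EuclideanSpace ℝ (Fin 3) → Fin N),
            (P = Literature.Geometry.DiscreteGeometry.fccKissingPattern ∨
              P = Literature.Geometry.DiscreteGeometry.hcpKissingPattern) ∧
            (∀ p ∈ P, (Literature.Geometry.DiscreteGeometry.bondGraph η y).Adj j (m p) ∧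
              dist (y (m p)) (y j + Literature.Geometry.DiscreteGeometry.nearestDist y j • A p) ≤
                Literature.Geometry.DiscreteGeometry.nearestDist y j / 4) ∧
            (∀ p ∈ P, ∀ q ∈ P, m p = m q → p = q) ∧
            (∀ p ∈ P, ∀ q ∈ P,
              ((Literature.Geometry.DiscreteGeometry.bondGraph η y).Adj (m p) (m q) ↔ dist p q = 1)) ∧
            (∀ l, (Literature.Geometry.DiscreteGeometry.bondGraph η y).Adj j l → ∃ p ∈ P, m p = l)) →
        ∃ (Pc : Fin N → Finset (EuclideanSpace ℝ (Fin 3)))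
          (Ac : Fin N → EuclideanSpace ℝ (Fin 3) →ₗᵢ[ℝ] EuclideanSpace ℝ (Fin 3))
          (mc : Fin N → EuclideanSpace ℝ (Fin 3) → Fin N),
          (∀ j : Fin N, dist (y i) (y j) ≤ 8 * Literature.Geometry.DiscreteGeometry.nearestDist y i →
            (Pc j = Literature.Geometry.DiscreteGeometry.fccKissingPattern ∨
              Pc j = Literature.Geometry.DiscreteGeometry.hcpKissingPattern) ∧
            (∀ p ∈ Pc j, (Literature.Geometry.DiscreteGeometry.bondGraph η y).Adj j (mc j p) ∧
              dist (y (mc j p)) (y j + Literature.Geometry.DiscreteGeometry.nearestDist y j • Ac j p) ≤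
                Literature.Geometry.DiscreteGeometry.nearestDist y j / 4) ∧
            (∀ p ∈ Pc j, ∀ q ∈ Pc j, mc j p = mc j q → p = q) ∧
            (∀ p ∈ Pc j, ∀ q ∈ Pc j,
              ((Literature.Geometry.DiscreteGeometry.bondGraph η y).Adj (mc j p) (mc j q) ↔ dist p q = 1)) ∧
            (∀ l, (Literature.Geometry.DiscreteGeometry.bondGraph η y).Adj j l → ∃ p ∈ Pc j, mc j p = l)) ∧
          (∀ j k : Fin N, dist (y i) (y j) ≤ 8 * Literature.Geometry.DiscreteGeometry.nearestDist y i →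
            dist (y i) (y k) ≤ 8 * Literature.Geometry.DiscreteGeometry.nearestDist y i → (Literature.Geometry.DiscreteGeometry.bondGraph η y).Adj j k →
            ∀ a b : Fin N, (Literature.Geometry.DiscreteGeometry.bondGraph η y).Adj j a → (Literature.Geometry.DiscreteGeometry.bondGraph η y).Adj j b → (Literature.Geometry.DiscreteGeometry.bondGraph η y).Adj k a → (Literature.Geometry.DiscreteGeometry.bondGraph η y).Adj k b → (Literature.Geometry.DiscreteGeometry.bondGraph η y).Adj a b →
            ∀ p₁ ∈ Pc j, ∀ p₂ ∈ Pc j, ∀ p₃ ∈ Pc j, mc j p₁ = k → mc j p₂ = a → mc j p₃ = b →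
            ∀ q₁ ∈ Pc k, ∀ q₂ ∈ Pc k, ∀ q₃ ∈ Pc k, mc k q₁ = j → mc k q₂ = a → mc k q₃ = b →
            Matrix.det ![WithLp.ofLp p₁, WithLp.ofLp p₂, WithLp.ofLp p₃] =
              - Matrix.det ![WithLp.ofLp q₁, WithLp.ofLp q₂, WithLp.ofLp q₃])) →
    (∀ η : ℝ, 0 < η → η ≤ 1 / 100 →
      ∀ (N : ℕ) (y : Fin N → EuclideanSpace ℝ (Fin 3)) (x : Fin N),
        0 < Literature.Geometry.DiscreteGeometry.nearestDist y x →
        (∀ j : Fin N, dist (y x) (y j) ≤ 5 / 2 * Literature.Geometry.DiscreteGeometry.nearestDist y x →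
          Literature.Geometry.DiscreteGeometry.IsChargeFree η y j) →
        (∀ j : Fin N, dist (y x) (y j) ≤ 5 / 2 * Literature.Geometry.DiscreteGeometry.nearestDist y x →
          ∃ (P : Finset (EuclideanSpace ℝ (Fin 3)))
            (A : EuclideanSpace ℝ (Fin 3) →ₗᵢ[ℝ] EuclideanSpace ℝ (Fin 3))
            (m : EuclideanSpace ℝ (Fin 3) → Fin N),
            (P = Literature.Geometry.DiscreteGeometry.fccKissingPattern ∨
              P = Literature.Geometry.DiscreteGeometry.hcpKissingPattern) ∧
            (∀ p ∈ P, (Literature.Geometry.DiscreteGeometry.bondGraph η y).Adj j (m p) ∧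
              dist (y (m p)) (y j + Literature.Geometry.DiscreteGeometry.nearestDist y j • A p) ≤
                Literature.Geometry.DiscreteGeometry.nearestDist y j / 4) ∧
            (∀ p ∈ P, ∀ q ∈ P, m p = m q → p = q) ∧
            (∀ p ∈ P, ∀ q ∈ P,
              ((Literature.Geometry.DiscreteGeometry.bondGraph η y).Adj (m p) (m q) ↔ dist p q = 1)) ∧
            (∀ l, (Literature.Geometry.DiscreteGeometry.bondGraph η y).Adj j l → ∃ p ∈ P, m p = l)) →
        ∀ (A : EuclideanSpace ℝ (Fin 3) →ₗᵢ[ℝ] EuclideanSpace ℝ (Fin 3)) (m : EuclideanSpace ℝ (Fin 3) → Fin N),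
          ((Literature.Geometry.DiscreteGeometry.fccKissingPattern = Literature.Geometry.DiscreteGeometry.fccKissingPattern ∨
            Literature.Geometry.DiscreteGeometry.fccKissingPattern = Literature.Geometry.DiscreteGeometry.hcpKissingPattern) ∧
          (∀ p ∈ Literature.Geometry.DiscreteGeometry.fccKissingPattern, (Literature.Geometry.DiscreteGeometry.bondGraph η y).Adj x (m p) ∧
            dist (y (m p)) (y x + Literature.Geometry.DiscreteGeometry.nearestDist y x • A p) ≤
              Literature.Geometry.DiscreteGeometry.nearestDist y x / 4) ∧
          (∀ p ∈ Literature.Geometry.DiscreteGeometry.fccKissingPattern, ∀ q ∈ Literature.Geometry.DiscreteGeometry.fccKissingPattern, m p = m q → p = q) ∧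
          (∀ p ∈ Literature.Geometry.DiscreteGeometry.fccKissingPattern, ∀ q ∈ Literature.Geometry.DiscreteGeometry.fccKissingPattern,
            ((Literature.Geometry.DiscreteGeometry.bondGraph η y).Adj (m p) (m q) ↔ dist p q = 1)) ∧
          (∀ l, (Literature.Geometry.DiscreteGeometry.bondGraph η y).Adj x l → ∃ p ∈ Literature.Geometry.DiscreteGeometry.fccKissingPattern, m p = l)) →
        ∀ u k t : Fin N, (Literature.Geometry.DiscreteGeometry.bondGraph η y).Adj x u → (Literature.Geometry.DiscreteGeometry.bondGraph η y).Adj x k → ¬ (Literature.Geometry.DiscreteGeometry.bondGraph η y).Adj u k → u ≠ k →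
          ¬ (Literature.Geometry.DiscreteGeometry.bondGraph η y).Adj x t → x ≠ t → (Literature.Geometry.DiscreteGeometry.bondGraph η y).Adj t u → (Literature.Geometry.DiscreteGeometry.bondGraph η y).Adj t k →
          ∃ c : Fin N, (Literature.Geometry.DiscreteGeometry.bondGraph η y).Adj x c ∧ (Literature.Geometry.DiscreteGeometry.bondGraph η y).Adj u c ∧ (Literature.Geometry.DiscreteGeometry.bondGraph η y).Adj k c ∧ (Literature.Geometry.DiscreteGeometry.bondGraph η y).Adj t c) →
    (∀ η : ℝ, 0 < η → η ≤ 1 / 100 →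
      ∀ (N : ℕ) (y : Fin N → EuclideanSpace ℝ (Fin 3)) (x : Fin N),
        0 < Literature.Geometry.DiscreteGeometry.nearestDist y x →
        (∀ j : Fin N, dist (y x) (y j) ≤ 5 / 2 * Literature.Geometry.DiscreteGeometry.nearestDist y x →
          Literature.Geometry.DiscreteGeometry.IsChargeFree η y j) →
        (∀ j : Fin N, dist (y x) (y j) ≤ 5 / 2 * Literature.Geometry.DiscreteGeometry.nearestDist y x →
          ∃ (P : Finset (EuclideanSpace ℝ (Fin 3)))
            (A : EuclideanSpace ℝ (Fin 3) →ₗᵢ[ℝ] EuclideanSpace ℝ (Fin 3))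
            (m : EuclideanSpace ℝ (Fin 3) → Fin N),
            (P = Literature.Geometry.DiscreteGeometry.fccKissingPattern ∨
              P = Literature.Geometry.DiscreteGeometry.hcpKissingPattern) ∧
            (∀ p ∈ P, (Literature.Geometry.DiscreteGeometry.bondGraph η y).Adj j (m p) ∧
              dist (y (m p)) (y j + Literature.Geometry.DiscreteGeometry.nearestDist y j • A p) ≤
                Literature.Geometry.DiscreteGeometry.nearestDist y j / 4) ∧
            (∀ p ∈ P, ∀ q ∈ P, m p = m q → p = q) ∧
            (∀ p ∈ P, ∀ q ∈ P,
              ((Literature.Geometry.DiscreteGeometry.bondGraph η y).Adj (m p) (m q) ↔ dist p q = 1)) ∧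
            (∀ l, (Literature.Geometry.DiscreteGeometry.bondGraph η y).Adj j l → ∃ p ∈ P, m p = l)) →
        ∀ (A : EuclideanSpace ℝ (Fin 3) →ₗᵢ[ℝ] EuclideanSpace ℝ (Fin 3)) (m : EuclideanSpace ℝ (Fin 3) → Fin N),
          ((Literature.Geometry.DiscreteGeometry.hcpKissingPattern = Literature.Geometry.DiscreteGeometry.fccKissingPattern ∨
            Literature.Geometry.DiscreteGeometry.hcpKissingPattern = Literature.Geometry.DiscreteGeometry.hcpKissingPattern) ∧
          (∀ p ∈ Literature.Geometry.DiscreteGeometry.hcpKissingPattern, (Literature.Geometry.DiscreteGeometry.bondGraph η y).Adj x (m p) ∧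
            dist (y (m p)) (y x + Literature.Geometry.DiscreteGeometry.nearestDist y x • A p) ≤
              Literature.Geometry.DiscreteGeometry.nearestDist y x / 4) ∧
          (∀ p ∈ Literature.Geometry.DiscreteGeometry.hcpKissingPattern, ∀ q ∈ Literature.Geometry.DiscreteGeometry.hcpKissingPattern, m p = m q → p = q) ∧
          (∀ p ∈ Literature.Geometry.DiscreteGeometry.hcpKissingPattern, ∀ q ∈ Literature.Geometry.DiscreteGeometry.hcpKissingPattern,
            ((Literature.Geometry.DiscreteGeometry.bondGraph η y).Adj (m p) (m q) ↔ dist p q = 1)) ∧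
          (∀ l, (Literature.Geometry.DiscreteGeometry.bondGraph η y).Adj x l → ∃ p ∈ Literature.Geometry.DiscreteGeometry.hcpKissingPattern, m p = l)) →
        ∀ u k t : Fin N, (Literature.Geometry.DiscreteGeometry.bondGraph η y).Adj x u → (Literature.Geometry.DiscreteGeometry.bondGraph η y).Adj x k → ¬ (Literature.Geometry.DiscreteGeometry.bondGraph η y).Adj u k → u ≠ k →
          ¬ (Literature.Geometry.DiscreteGeometry.bondGraph η y).Adj x t → x ≠ t → (Literature.Geometry.DiscreteGeometry.bondGraph η y).Adj t u → (Literature.Geometry.DiscreteGeometry.bondGraph η y).Adj t k →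
          ∃ c : Fin N, (Literature.Geometry.DiscreteGeometry.bondGraph η y).Adj x c ∧ (Literature.Geometry.DiscreteGeometry.bondGraph η y).Adj u c ∧ (Literature.Geometry.DiscreteGeometry.bondGraph η y).Adj k c ∧ (Literature.Geometry.DiscreteGeometry.bondGraph η y).Adj t c) →
    ∀ η : ℝ, 0 < η → η ≤ 1 / 100 →
      ∀ (N : ℕ) (y : Fin N → EuclideanSpace ℝ (Fin 3)) (i : Fin N),
        0 < Literature.Geometry.DiscreteGeometry.nearestDist y i →
        (∀ j : Fin N, dist (y i) (y j) ≤ 8 * Literature.Geometry.DiscreteGeometry.nearestDist y i →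
          Literature.Geometry.DiscreteGeometry.IsChargeFree η y j) →
        (∀ j : Fin N, dist (y i) (y j) ≤ 8 * Literature.Geometry.DiscreteGeometry.nearestDist y i →
          ∃ (P : Finset (EuclideanSpace ℝ (Fin 3)))
            (A : EuclideanSpace ℝ (Fin 3) →ₗᵢ[ℝ] EuclideanSpace ℝ (Fin 3))
            (m : EuclideanSpace ℝ (Fin 3) → Fin N),
            (P = Literature.Geometry.DiscreteGeometry.fccKissingPattern ∨
              P = Literature.Geometry.DiscreteGeometry.hcpKissingPattern) ∧
            (∀ p ∈ P, (Literature.Geometry.DiscreteGeometry.bondGraph η y).Adj j (m p) ∧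
              dist (y (m p)) (y j + Literature.Geometry.DiscreteGeometry.nearestDist y j • A p) ≤
                Literature.Geometry.DiscreteGeometry.nearestDist y j / 4) ∧
            (∀ p ∈ P, ∀ q ∈ P, m p = m q → p = q) ∧
            (∀ p ∈ P, ∀ q ∈ P,
              ((Literature.Geometry.DiscreteGeometry.bondGraph η y).Adj (m p) (m q) ↔
                dist p q = 1)) ∧
            (∀ k, (Literature.Geometry.DiscreteGeometry.bondGraph η y).Adj j k → ∃ p ∈ P, m p = k)) →
        ∃ D : Fin N → EuclideanSpace ℝ (Fin 3),
          ∀ j : Fin N, (∃ w : (Literature.Geometry.DiscreteGeometry.bondGraph η y).Walk i j, w.length ≤ 5) →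
            ∃ (P : Finset (EuclideanSpace ℝ (Fin 3)))
              (Q R : EuclideanSpace ℝ (Fin 3) →ₗᵢ[ℝ] EuclideanSpace ℝ (Fin 3)),
              (P = Literature.Geometry.DiscreteGeometry.fccKissingPattern ∨
                P = Literature.Geometry.DiscreteGeometry.hcpKissingPattern) ∧
              D '' {k | (Literature.Geometry.DiscreteGeometry.bondGraph η y).Adj j k} =
                (fun p => D j + Q p) '' (P : Set (EuclideanSpace ℝ (Fin 3))) ∧
              (∀ k, (Literature.Geometry.DiscreteGeometry.bondGraph η y).Adj j k →
                ‖(y k - y j) - Literature.Geometry.DiscreteGeometry.nearestDist y j • R (D k - D j)‖ ≤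
                  Literature.Geometry.DiscreteGeometry.nearestDist y j / 4) ∧
              (∀ k k', (Literature.Geometry.DiscreteGeometry.bondGraph η y).Adj j k →
                (Literature.Geometry.DiscreteGeometry.bondGraph η y).Adj j k' →
                ((Literature.Geometry.DiscreteGeometry.bondGraph η y).Adj k k' ↔
                  dist (D k) (D k') = 1)) := by
  exact Summit.AtomisticToContinuum.Crystallization.Theorems.develop_rest_of_orderedCaps develop_H1R

/-- **stub_develop** (development of the exact shadow crystal on the GRAPH `5`-ball; v4: PROVED from the
registered stubs `develop_HO`, `develop_HX_fcc`, `develop_HX_hcp`, `develop_rest`).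
If `nn_i > 0`, every site within `8·nn_i` of `y i` is charge-free at `η ∈ (0, 1/100]` and carries
an exact labelled chart (conclusion of `stub_chartAssembly`), then there are unit-scale shadow
positions `D : Fin N → ℝ³` such that at every site `j` joined to `i` by a bond walk of length `≤ 5`
the bond-neighbours of `j` are carried by `D` EXACTLY onto a rotated FCC/HCP pattern about `D j`, the real
bond vectors are within `nn_j/4` of `nn_j •` a rotated copy of the shadow bond vectors, and bonds
among neighbours of `j` are exactly the unit distances of `D`. -/
theorem stub_develop :
    ∀ η : ℝ, 0 < η → η ≤ 1 / 100 →
      ∀ (N : ℕ) (y : Fin N → EuclideanSpace ℝ (Fin 3)) (i : Fin N),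
        0 < Literature.Geometry.DiscreteGeometry.nearestDist y i →
        (∀ j : Fin N, dist (y i) (y j) ≤ 8 * Literature.Geometry.DiscreteGeometry.nearestDist y i →
          Literature.Geometry.DiscreteGeometry.IsChargeFree η y j) →
        (∀ j : Fin N, dist (y i) (y j) ≤ 8 * Literature.Geometry.DiscreteGeometry.nearestDist y i →
          ∃ (P : Finset (EuclideanSpace ℝ (Fin 3)))
            (A : EuclideanSpace ℝ (Fin 3) →ₗᵢ[ℝ] EuclideanSpace ℝ (Fin 3))
            (m : EuclideanSpace ℝ (Fin 3) → Fin N),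
            (P = Literature.Geometry.DiscreteGeometry.fccKissingPattern ∨
              P = Literature.Geometry.DiscreteGeometry.hcpKissingPattern) ∧
            (∀ p ∈ P, (Literature.Geometry.DiscreteGeometry.bondGraph η y).Adj j (m p) ∧
              dist (y (m p)) (y j + Literature.Geometry.DiscreteGeometry.nearestDist y j • A p) ≤
                Literature.Geometry.DiscreteGeometry.nearestDist y j / 4) ∧
            (∀ p ∈ P, ∀ q ∈ P, m p = m q → p = q) ∧
            (∀ p ∈ P, ∀ q ∈ P,
              ((Literature.Geometry.DiscreteGeometry.bondGraph η y).Adj (m p) (m q) ↔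
                dist p q = 1)) ∧
            (∀ k, (Literature.Geometry.DiscreteGeometry.bondGraph η y).Adj j k → ∃ p ∈ P, m p = k)) →
        ∃ D : Fin N → EuclideanSpace ℝ (Fin 3),
          ∀ j : Fin N, (∃ w : (Literature.Geometry.DiscreteGeometry.bondGraph η y).Walk i j, w.length ≤ 5) →
            ∃ (P : Finset (EuclideanSpace ℝ (Fin 3)))
              (Q R : EuclideanSpace ℝ (Fin 3) →ₗᵢ[ℝ] EuclideanSpace ℝ (Fin 3)),
              (P = Literature.Geometry.DiscreteGeometry.fccKissingPattern ∨
                P = Literature.Geometry.DiscreteGeometry.hcpKissingPattern) ∧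
              D '' {k | (Literature.Geometry.DiscreteGeometry.bondGraph η y).Adj j k} =
                (fun p => D j + Q p) '' (P : Set (EuclideanSpace ℝ (Fin 3))) ∧
              (∀ k, (Literature.Geometry.DiscreteGeometry.bondGraph η y).Adj j k →
                ‖(y k - y j) - Literature.Geometry.DiscreteGeometry.nearestDist y j • R (D k - D j)‖ ≤
                  Literature.Geometry.DiscreteGeometry.nearestDist y j / 4) ∧
              (∀ k k', (Literature.Geometry.DiscreteGeometry.bondGraph η y).Adj j k →
                (Literature.Geometry.DiscreteGeometry.bondGraph η y).Adj j k' →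
                ((Literature.Geometry.DiscreteGeometry.bondGraph η y).Adj k k' ↔
                  dist (D k) (D k') = 1)) :=
  develop_rest develop_HO develop_HX_fcc develop_HX_hcp


/-- **stub_oneStackingMap** (v7, lead c3, 2026-08-17; η = 0 in substance, MAP-based, exact and finite —
replaces v6's `stub_oneStacking`, whose set-based engine `H0` "can never be fed" at radius 8, c2 §3(a)).
THE GRAPH-BALL ENGINE.  Given the exact development `D` on the graph `5`-ball about `i` (conclusion of
`stub_develop`: at every such site the bond-neighbours are carried EXACTLY onto a rotated FCC/HCP pattern,
bonds among them are exactly the unit shadow distances), there are a Hägg sequence `s` and a rigid motion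
`φ` of shadow space such that, writing `T₅` for the graph `5`-ball and `33/10` for the engine radius:
(membership) every `j ∈ T₅` with `dist (D j) (D i) ≤ 33/10` has `φ (D j) ∈ barlowStacking 1 √(2/3) s`;
(surjectivity) every stacking point within `33/10` of `φ (D i)` is `φ (D j)` for such a `j`;
(injectivity) two such sites with the same shadow coincide.
Why `33/10`, and why not more, from a graph `5`-ball (exact computations of this session, unit `nn`):
(a) in EVERY Barlow stacking the graph `5`-ball contains the shadow ball of radius `3√2 = 4.2426` and the
graph `4`-ball (whose sites have complete exact shells here) that of radius `√13 = 3.6056`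
(work/num/inradius.py: fcc, hcp, dhcp, twins, 12 random Hägg words); (b) the exact obstruction is the
double twin (three fcc grains, two coherent Σ3 planes of the middle grain `B` meeting on a `⟨1,-1,0⟩`
junction row; disprover's `¬ SLP (14/5) 3 (1/6)`, strategist's metric staircase j023867); recomputed in
GRAPH terms (work/num/tjunction.py, tjunction2.py): with `B` in the OBTUSE wedge (109.5°) the row is reached
along a straight bond row and no centre with an exact graph `5`-ball fails below radius `5.29` (graph
`4`-ball: `√(65/3) = 4.65`); with `B` in the ACUTE wedge (70.5°, the twin-lamella tip) the apex is reached
along the `4`-fold zig-zag, the centre `6` bonds (= `3√2` metric) up the bisector has an exact graph `5`-ball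
and sees both foreign grains at EXACTLY `√11 = 3.3166` — so the engine radius must be `< √11`; `33/10` it is,
and the proof must be sharp (the extremal wedge geometry must come out exactly).
Proof plan (Hales DSP §1.3 order, on the abstract development): `h`-sites carry one hexagonal plane, which
propagates to in-plane neighbours (tree: `Literature/…/LayerShells`, `LayerPropagation` local lemmas, to be
re-run on exact stars instead of kissing shells of a packing); two `h`-discs on non-parallel planes that both
carry foreign material inside the `33/10`-ball force a non-pattern star within graph distance `5` (the wedge
computation above is the quantitative content: junction row within `√11`-geometry); parallel `h`-discs + fcc
slabs = one stacking (tree: `LayerStackings`, landed `…StubBallPropagationStacking`); surjectivity by outward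
induction over complete exact shells (graph `4`-ball ⊇ shadow `3.6`); injectivity because a site and its
ghost would have graph distance ≥ 3 yet identical exact stars inside one stacking ball. -/
theorem stub_oneStackingMap :
    ∀ η : ℝ, 0 < η → η ≤ 1 / 100 →
      ∀ (N : ℕ) (y : Fin N → EuclideanSpace ℝ (Fin 3)) (i : Fin N),
        0 < Literature.Geometry.DiscreteGeometry.nearestDist y i →
        (∀ j : Fin N, dist (y i) (y j) ≤ 8 * Literature.Geometry.DiscreteGeometry.nearestDist y i →
          Literature.Geometry.DiscreteGeometry.IsChargeFree η y j) →
        ∀ D : Fin N → EuclideanSpace ℝ (Fin 3),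
          (∀ j : Fin N, (∃ w : (Literature.Geometry.DiscreteGeometry.bondGraph η y).Walk i j, w.length ≤ 5) →
            ∃ (P : Finset (EuclideanSpace ℝ (Fin 3)))
              (Q R : EuclideanSpace ℝ (Fin 3) →ₗᵢ[ℝ] EuclideanSpace ℝ (Fin 3)),
              (P = Literature.Geometry.DiscreteGeometry.fccKissingPattern ∨
                P = Literature.Geometry.DiscreteGeometry.hcpKissingPattern) ∧
              D '' {k | (Literature.Geometry.DiscreteGeometry.bondGraph η y).Adj j k} =
                (fun p => D j + Q p) '' (P : Set (EuclideanSpace ℝ (Fin 3))) ∧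
              (∀ k, (Literature.Geometry.DiscreteGeometry.bondGraph η y).Adj j k →
                ‖(y k - y j) - Literature.Geometry.DiscreteGeometry.nearestDist y j • R (D k - D j)‖ ≤
                  Literature.Geometry.DiscreteGeometry.nearestDist y j / 4) ∧
              (∀ k k', (Literature.Geometry.DiscreteGeometry.bondGraph η y).Adj j k →
                (Literature.Geometry.DiscreteGeometry.bondGraph η y).Adj j k' →
                ((Literature.Geometry.DiscreteGeometry.bondGraph η y).Adj k k' ↔
                  dist (D k) (D k') = 1))) →
          ∃ (s : ℤ → ℤ) (φ : EuclideanSpace ℝ (Fin 3) ≃ᵃⁱ[ℝ] EuclideanSpace ℝ (Fin 3)),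
            Literature.MathematicalPhysics.StatisticalMechanics.IsHaggSeq s ∧
            (∀ j : Fin N, (∃ w : (Literature.Geometry.DiscreteGeometry.bondGraph η y).Walk i j, w.length ≤ 5) →
              dist (D j) (D i) ≤ 33 / 10 →
              φ (D j) ∈ Literature.MathematicalPhysics.StatisticalMechanics.barlowStacking 1
                (Real.sqrt (2 / 3)) s) ∧
            (∀ z ∈ Literature.MathematicalPhysics.StatisticalMechanics.barlowStacking 1
                (Real.sqrt (2 / 3)) s,
              dist z (φ (D i)) ≤ 33 / 10 →
              ∃ j : Fin N, (∃ w : (Literature.Geometry.DiscreteGeometry.bondGraph η y).Walk i j,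
                w.length ≤ 5) ∧ dist (D j) (D i) ≤ 33 / 10 ∧ φ (D j) = z) ∧
            (∀ j k : Fin N, (∃ w : (Literature.Geometry.DiscreteGeometry.bondGraph η y).Walk i j, w.length ≤ 5) →
              (∃ w : (Literature.Geometry.DiscreteGeometry.bondGraph η y).Walk i k, w.length ≤ 5) →
              dist (D j) (D i) ≤ 33 / 10 → dist (D k) (D i) ≤ 33 / 10 → D j = D k → j = k) := by
  sorry

/-- **stub_realBall** (v7; metric, one-sided but near-sharp: L+; = clause (ii) of v6's `stub_oneStacking`
with `7/2` sharpened to the engine radius `33/10`).  THE REAL BALL IS INSIDE THE BARLOW SHADOW BALL.  Given the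
charge-free `8·nn_i`-ball, the exact development `D` on the graph `5`-ball and the stacking data of
`stub_oneStackingMap` at radius `33/10`: every site `j` with `dist (y i) (y j) ≤ 3·nn_i` lies in the graph
`5`-ball and has shadow within `33/10` of `D i`.  Truth: shadow ≈ real/(mean scale) + deviation ≤ 3/0.98 + 0.08
≈ 3.14 (scale may fall 1 %/shell outward; the two-way deviation at radius 3 is ≤ 0.0715·nn in the worst
legitimate configuration, c2 METRIC-REPORT); margin ≈ 0.15·nn — NOT coarse.  Also "`j` is in the graph
`5`-ball" is a real→graph statement: descent through `1/4`-charts stalls at `1.03·nn` (fixed point of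
`d ↦ √(d²+1−√2·d) + 1/4`) and Tammes-13 excludes a 13th site only out to `1.06·nn_i`, so this needs two-sided
position tracking of the graph `5`-ball (the licence's machinery at tolerance ≈ 0.15) plus local covering by
exact second shells and hard core.  Expected to be proved together with / right after `stub_licence`. -/
theorem stub_realBall :
    ∀ η : ℝ, 0 < η → η ≤ 1 / 100 →
      ∀ (N : ℕ) (y : Fin N → EuclideanSpace ℝ (Fin 3)) (i : Fin N),
        0 < Literature.Geometry.DiscreteGeometry.nearestDist y i →
        (∀ j : Fin N, dist (y i) (y j) ≤ 8 * Literature.Geometry.DiscreteGeometry.nearestDist y i →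
          Literature.Geometry.DiscreteGeometry.IsChargeFree η y j) →
        ∀ (D : Fin N → EuclideanSpace ℝ (Fin 3))
          (φ : EuclideanSpace ℝ (Fin 3) ≃ᵃⁱ[ℝ] EuclideanSpace ℝ (Fin 3)) (s : ℤ → ℤ),
          (∀ j : Fin N, (∃ w : (Literature.Geometry.DiscreteGeometry.bondGraph η y).Walk i j, w.length ≤ 5) →
            ∃ (P : Finset (EuclideanSpace ℝ (Fin 3)))
              (Q R : EuclideanSpace ℝ (Fin 3) →ₗᵢ[ℝ] EuclideanSpace ℝ (Fin 3)),
              (P = Literature.Geometry.DiscreteGeometry.fccKissingPattern ∨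
                P = Literature.Geometry.DiscreteGeometry.hcpKissingPattern) ∧
              D '' {k | (Literature.Geometry.DiscreteGeometry.bondGraph η y).Adj j k} =
                (fun p => D j + Q p) '' (P : Set (EuclideanSpace ℝ (Fin 3))) ∧
              (∀ k, (Literature.Geometry.DiscreteGeometry.bondGraph η y).Adj j k →
                ‖(y k - y j) - Literature.Geometry.DiscreteGeometry.nearestDist y j • R (D k - D j)‖ ≤
                  Literature.Geometry.DiscreteGeometry.nearestDist y j / 4) ∧
              (∀ k k', (Literature.Geometry.DiscreteGeometry.bondGraph η y).Adj j k →
                (Literature.Geometry.DiscreteGeometry.bondGraph η y).Adj j k' →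
                ((Literature.Geometry.DiscreteGeometry.bondGraph η y).Adj k k' ↔
                  dist (D k) (D k') = 1))) →
          Literature.MathematicalPhysics.StatisticalMechanics.IsHaggSeq s →
          (∀ j : Fin N, (∃ w : (Literature.Geometry.DiscreteGeometry.bondGraph η y).Walk i j, w.length ≤ 5) →
            dist (D j) (D i) ≤ 33 / 10 →
            φ (D j) ∈ Literature.MathematicalPhysics.StatisticalMechanics.barlowStacking 1
              (Real.sqrt (2 / 3)) s) →
          (∀ z ∈ Literature.MathematicalPhysics.StatisticalMechanics.barlowStacking 1
              (Real.sqrt (2 / 3)) s,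
            dist z (φ (D i)) ≤ 33 / 10 →
            ∃ j : Fin N, (∃ w : (Literature.Geometry.DiscreteGeometry.bondGraph η y).Walk i j,
              w.length ≤ 5) ∧ dist (D j) (D i) ≤ 33 / 10 ∧ φ (D j) = z) →
          (∀ j k : Fin N, (∃ w : (Literature.Geometry.DiscreteGeometry.bondGraph η y).Walk i j, w.length ≤ 5) →
            (∃ w : (Literature.Geometry.DiscreteGeometry.bondGraph η y).Walk i k, w.length ≤ 5) →
            dist (D j) (D i) ≤ 33 / 10 → dist (D k) (D i) ≤ 33 / 10 → D j = D k → j = k) →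
          ∀ j : Fin N, dist (y i) (y j) ≤ 3 * Literature.Geometry.DiscreteGeometry.nearestDist y i →
            (∃ w : (Literature.Geometry.DiscreteGeometry.bondGraph η y).Walk i j, w.length ≤ 5) ∧
              dist (D j) (D i) ≤ 33 / 10 := by
  sorry


/-! ## The new stub of this line: conformal–affine proximity (replaces `Sketch.stub_licence`) -/

/- Constants of the split (all inlined as numerals below): `Cmax = 3/400` (special-conformal vector `c`,
units `1/nn`; linear extremal `≈ 0.707·η`), `Lmax = 1/250` (dilation `λ` relative to the pinned scale `nn_i`;
linear extremal `≈ η/3`), `Emax = 3/400` (operator norm of the trace-less strain `S`; linear extremal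
`≈ 2η/3`), `δ₁ = 23/500` (sup-norm budget of the NON-conformal–affine residual);
`δ₂ = (Lmax + Emax)·33/10 + Cmax·(33/10)² = 0.119625`, `δ₁ + δ₂ = 0.165625 ≤ 1/6` (`budget_le`). -/

/-- **stub_caProximity** (OPEN; the new stub of line `moebius-split`; certified-numerics class but with
slack — see the line card for the measured linear values; CONSTANTS PROVISIONAL until kit j026859/j026860 land: the
box margins over the linear extremals are 6 % (`c`), 20 % (`λ`), 12 % (`S`) and `δ₁ = 23/500` is the residual budget —
they will be re-set from the parameter-range / residual LPs and this file re-published at the same path).  CONFORMAL–AFFINE PROXIMITY.  In the situation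
of `Sketch.stub_licence` (charge-free `8·nn_i`-ball, the exact development `D` on the graph `5`-ball, one
stacking `s, φ` with membership / surjectivity / injectivity at shadow radius `33/10`) there are a rigid
motion `g₀`, a vector `c`, a number `λ` and a linear map `S` with `‖c‖ ≤ Cmax`, `|λ| ≤ Lmax`,
`‖S v‖ ≤ Emax·‖v‖`, such that every developed site `j` with shadow `x := φ (D j) − φ (D i)` of norm
`≤ 33/10` satisfies `dist (y j) (g₀ (nn_i • (x + λx + Sx + 2⟪c,x⟫x − ‖x‖²c))) ≤ δ₁·nn_i`.
(Intended proof: (i) LP-certified ranges of the bulk parameters `c, λ, S` of the least-squares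
conformal–affine fit — averages, remainder negligible; (ii) rotation² remainder boxes made EXPLICIT from
the fitted conformal–affine part plus a crude residual allowance — no bootstrap; (iii) one sup-norm LP
dual certificate per reference environment (exact developments of graph-`5`-balls whose shadow
`33/10`-ball is one stacking: all Hägg words of the `±4` layers, plus inclined coherent twins outside
`33/10`) for the residual, checked over `ℚ`.) -/
theorem stub_caProximity :
    ∀ η : ℝ, 0 < η → η ≤ 1 / 100 →
      ∀ (N : ℕ) (y : Fin N → EuclideanSpace ℝ (Fin 3)) (i : Fin N),
        0 < Literature.Geometry.DiscreteGeometry.nearestDist y i →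
        (∀ j : Fin N, dist (y i) (y j) ≤ 8 * Literature.Geometry.DiscreteGeometry.nearestDist y i →
          Literature.Geometry.DiscreteGeometry.IsChargeFree η y j) →
        ∀ (D : Fin N → EuclideanSpace ℝ (Fin 3))
          (φ : EuclideanSpace ℝ (Fin 3) ≃ᵃⁱ[ℝ] EuclideanSpace ℝ (Fin 3)) (s : ℤ → ℤ),
          (∀ j : Fin N, (∃ w : (Literature.Geometry.DiscreteGeometry.bondGraph η y).Walk i j, w.length ≤ 5) →
            ∃ (P : Finset (EuclideanSpace ℝ (Fin 3)))
              (Q R : EuclideanSpace ℝ (Fin 3) →ₗᵢ[ℝ] EuclideanSpace ℝ (Fin 3)),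
              (P = Literature.Geometry.DiscreteGeometry.fccKissingPattern ∨
                P = Literature.Geometry.DiscreteGeometry.hcpKissingPattern) ∧
              D '' {k | (Literature.Geometry.DiscreteGeometry.bondGraph η y).Adj j k} =
                (fun p => D j + Q p) '' (P : Set (EuclideanSpace ℝ (Fin 3))) ∧
              (∀ k, (Literature.Geometry.DiscreteGeometry.bondGraph η y).Adj j k →
                ‖(y k - y j) - Literature.Geometry.DiscreteGeometry.nearestDist y j • R (D k - D j)‖ ≤
                  Literature.Geometry.DiscreteGeometry.nearestDist y j / 4) ∧
              (∀ k k', (Literature.Geometry.DiscreteGeometry.bondGraph η y).Adj j k →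
                (Literature.Geometry.DiscreteGeometry.bondGraph η y).Adj j k' →
                ((Literature.Geometry.DiscreteGeometry.bondGraph η y).Adj k k' ↔
                  dist (D k) (D k') = 1))) →
          Literature.MathematicalPhysics.StatisticalMechanics.IsHaggSeq s →
          (∀ j : Fin N, (∃ w : (Literature.Geometry.DiscreteGeometry.bondGraph η y).Walk i j, w.length ≤ 5) →
            dist (D j) (D i) ≤ 33 / 10 →
            φ (D j) ∈ Literature.MathematicalPhysics.StatisticalMechanics.barlowStacking 1
              (Real.sqrt (2 / 3)) s) →
          (∀ z ∈ Literature.MathematicalPhysics.StatisticalMechanics.barlowStacking 1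
              (Real.sqrt (2 / 3)) s,
            dist z (φ (D i)) ≤ 33 / 10 →
            ∃ j : Fin N, (∃ w : (Literature.Geometry.DiscreteGeometry.bondGraph η y).Walk i j,
              w.length ≤ 5) ∧ dist (D j) (D i) ≤ 33 / 10 ∧ φ (D j) = z) →
          (∀ j k : Fin N, (∃ w : (Literature.Geometry.DiscreteGeometry.bondGraph η y).Walk i j, w.length ≤ 5) →
            (∃ w : (Literature.Geometry.DiscreteGeometry.bondGraph η y).Walk i k, w.length ≤ 5) →
            dist (D j) (D i) ≤ 33 / 10 → dist (D k) (D i) ≤ 33 / 10 → D j = D k → j = k) →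
          ∃ (g₀ : EuclideanSpace ℝ (Fin 3) ≃ᵃⁱ[ℝ] EuclideanSpace ℝ (Fin 3))
            (c : EuclideanSpace ℝ (Fin 3)) (lam : ℝ)
            (S : EuclideanSpace ℝ (Fin 3) →ₗ[ℝ] EuclideanSpace ℝ (Fin 3)),
            ‖c‖ ≤ (3 / 400 : ℝ) ∧ |lam| ≤ (1 / 250 : ℝ) ∧ (∀ v, ‖S v‖ ≤ (3 / 400 : ℝ) * ‖v‖) ∧
            ∀ j : Fin N, (∃ w : (Literature.Geometry.DiscreteGeometry.bondGraph η y).Walk i j, w.length ≤ 5) →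
              dist (D j) (D i) ≤ 33 / 10 →
              dist (y j) (g₀ (Literature.Geometry.DiscreteGeometry.nearestDist y i •
                (φ (D j) - φ (D i) + lam • (φ (D j) - φ (D i)) + S (φ (D j) - φ (D i)) +
                  (2 * inner ℝ c (φ (D j) - φ (D i))) • (φ (D j) - φ (D i)) -
                  ‖φ (D j) - φ (D i)‖ ^ 2 • c))) ≤
                (23 / 500 : ℝ) * Literature.Geometry.DiscreteGeometry.nearestDist y i := by
  sorry

/-! ## Algebra of the conformal–affine family (fully proved) -/

/-- **The special-conformal quadratic field has norm `‖c‖·‖x‖²`**: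
`‖2⟪c,x⟫x − ‖x‖²c‖ = ‖c‖·‖x‖²` (it is `‖x‖²` times the reflection of `c` in the line `ℝx`). -/
theorem norm_confField (c x : E3) :
    ‖(2 * ⟪c, x⟫_ℝ) • x - ‖x‖ ^ 2 • c‖ = ‖c‖ * ‖x‖ ^ 2 := by
  have hx : 0 ≤ ‖x‖ := norm_nonneg x
  have hc : 0 ≤ ‖c‖ := norm_nonneg c
  have key : ‖(2 * ⟪c, x⟫_ℝ) • x - ‖x‖ ^ 2 • c‖ ^ 2 = (‖c‖ * ‖x‖ ^ 2) ^ 2 := by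
    rw [@norm_sub_sq_real, norm_smul, norm_smul, inner_smul_left, inner_smul_right,
      real_inner_comm x c]
    simp only [Real.norm_eq_abs, abs_mul, abs_two, abs_pow, abs_norm, conj_trivial, mul_pow, sq_abs]
    ring
  have h1 : 0 ≤ ‖(2 * ⟪c, x⟫_ℝ) • x - ‖x‖ ^ 2 • c‖ := norm_nonneg _
  have h2 : 0 ≤ ‖c‖ * ‖x‖ ^ 2 := by positivity
  nlinarith [key, h1, h2, sq_nonneg (‖(2 * ⟪c, x⟫_ℝ) • x - ‖x‖ ^ 2 • c‖ - ‖c‖ * ‖x‖ ^ 2)]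

/-- **Deviation of the conformal–affine family from the identity** on the ball of radius `33/10`
(triangle inequality; the translation is not even used): with the parameter box of `stub_caProximity`
the field `λx + Sx + 2⟪c,x⟫x − ‖x‖²c` has norm at most
`δ₂ := (1/250 + 3/400)·(33/10) + (3/400)·(33/10)²`. -/
theorem caDeviation_le (c : E3) (lam : ℝ) (S : E3 →ₗ[ℝ] E3)
    (hc : ‖c‖ ≤ 3 / 400) (hl : |lam| ≤ 1 / 250) (hS : ∀ v, ‖S v‖ ≤ 3 / 400 * ‖v‖)
    (x : E3) (hx : ‖x‖ ≤ 33 / 10) :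
    ‖lam • x + S x + (2 * ⟪c, x⟫_ℝ) • x - ‖x‖ ^ 2 • c‖ ≤
      (1 / 250 + 3 / 400) * (33 / 10) + 3 / 400 * (33 / 10) ^ 2 := by
  have h0 : 0 ≤ ‖x‖ := norm_nonneg x
  have hA : ‖lam • x‖ ≤ 1 / 250 * ‖x‖ := by
    rw [norm_smul, Real.norm_eq_abs]; exact mul_le_mul_of_nonneg_right hl h0
  have hB : ‖S x‖ ≤ 3 / 400 * ‖x‖ := hS x
  have hC : ‖(2 * ⟪c, x⟫_ℝ) • x - ‖x‖ ^ 2 • c‖ ≤ 3 / 400 * ‖x‖ ^ 2 := by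
    rw [norm_confField]; exact mul_le_mul_of_nonneg_right hc (by positivity)
  calc ‖lam • x + S x + (2 * ⟪c, x⟫_ℝ) • x - ‖x‖ ^ 2 • c‖
      = ‖(lam • x + S x) + ((2 * ⟪c, x⟫_ℝ) • x - ‖x‖ ^ 2 • c)‖ := by abel_nf
    _ ≤ ‖lam • x + S x‖ + ‖(2 * ⟪c, x⟫_ℝ) • x - ‖x‖ ^ 2 • c‖ := norm_add_le _ _
    _ ≤ (‖lam • x‖ + ‖S x‖) + ‖(2 * ⟪c, x⟫_ℝ) • x - ‖x‖ ^ 2 • c‖ := by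
        gcongr; exact norm_add_le _ _
    _ ≤ (1 / 250 * ‖x‖ + 3 / 400 * ‖x‖) + 3 / 400 * ‖x‖ ^ 2 := by gcongr
    _ ≤ (1 / 250 + 3 / 400) * (33 / 10) + 3 / 400 * (33 / 10) ^ 2 := by nlinarith

/-- The budget closes: `δ₁ + δ₂ ≤ 1/6`
(`23/500 + (1/250 + 3/400)·3.3 + (3/400)·10.89 = 0.046 + 0.03795 + 0.081675 = 0.165625`). -/
theorem budget_le : (23 / 500 : ℝ) + ((1 / 250 + 3 / 400) * (33 / 10) + 3 / 400 * (33 / 10) ^ 2) ≤ 1 / 6 := by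
  norm_num

/-- **The licence from conformal–affine proximity** (= the conclusion of `Sketch.stub_licence`, derived
from `stub_caProximity`, `caDeviation_le` and `budget_le`): composing `g₀` with the translation by
`−nn_i • φ (D i)` gives ONE rigid motion `g` with `dist (y j) (g (nn_i • φ (D j))) ≤ nn_i / 6` on the shadow
`33/10`-ball. -/
theorem licence_of_ca
    {N : ℕ} {η : ℝ} {y : Fin N → E3} {i : Fin N} (hpos : 0 < nearestDist y i)
    {D : Fin N → E3} {φ : E3 ≃ᵃⁱ[ℝ] E3}
    (H : ∃ (g₀ : E3 ≃ᵃⁱ[ℝ] E3) (c : E3) (lam : ℝ) (S : E3 →ₗ[ℝ] E3),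
      ‖c‖ ≤ (3 / 400 : ℝ) ∧ |lam| ≤ (1 / 250 : ℝ) ∧ (∀ v, ‖S v‖ ≤ (3 / 400 : ℝ) * ‖v‖) ∧
      ∀ j : Fin N, (∃ w : (bondGraph η y).Walk i j, w.length ≤ 5) → dist (D j) (D i) ≤ 33 / 10 →
        dist (y j) (g₀ (nearestDist y i •
          (φ (D j) - φ (D i) + lam • (φ (D j) - φ (D i)) + S (φ (D j) - φ (D i)) +
            (2 * ⟪c, φ (D j) - φ (D i)⟫_ℝ) • (φ (D j) - φ (D i)) - ‖φ (D j) - φ (D i)‖ ^ 2 • c))) ≤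
          (23 / 500 : ℝ) * nearestDist y i) :
    ∃ g : E3 ≃ᵃⁱ[ℝ] E3, ∀ j : Fin N, (∃ w : (bondGraph η y).Walk i j, w.length ≤ 5) →
      dist (D j) (D i) ≤ 33 / 10 → dist (y j) (g (nearestDist y i • φ (D j))) ≤ nearestDist y i / 6 := by
  obtain ⟨g₀, c, lam, S, hc, hl, hS, hprox⟩ := H
  set a : ℝ := nearestDist y i with ha
  -- `g` := translate by `−a • φ (D i)`, then `g₀`
  refine ⟨(AffineIsometryEquiv.constVAdd ℝ E3 (-(a • φ (D i)))).trans g₀, ?_⟩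
  intro j hw hd
  have hx : ‖φ (D j) - φ (D i)‖ ≤ 33 / 10 := by
    rw [← dist_eq_norm, φ.dist_map]; exact hd
  set x : E3 := φ (D j) - φ (D i) with hxdef
  set w : E3 := lam • x + S x + (2 * ⟪c, x⟫_ℝ) • x - ‖x‖ ^ 2 • c with hwdef
  have hdev : ‖w‖ ≤ (1 / 250 + 3 / 400) * (33 / 10) + 3 / 400 * (33 / 10) ^ 2 :=
    caDeviation_le c lam S hc hl hS x hx
  have hp := hprox j hw hd
  -- the comparison points
  have e1 : ((AffineIsometryEquiv.constVAdd ℝ E3 (-(a • φ (D i)))).trans g₀) (a • φ (D j)) =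
      g₀ (a • x) := by
    simp only [AffineIsometryEquiv.coe_trans, Function.comp_apply, AffineIsometryEquiv.coe_constVAdd,
      vadd_eq_add, hxdef, smul_sub]
    congr 1; abel
  have e2 : a • (φ (D j) - φ (D i) + lam • (φ (D j) - φ (D i)) + S (φ (D j) - φ (D i)) +
        (2 * ⟪c, φ (D j) - φ (D i)⟫_ℝ) • (φ (D j) - φ (D i)) - ‖φ (D j) - φ (D i)‖ ^ 2 • c) =
      a • x + a • w := by
    simp only [hxdef, hwdef, ← smul_add]; congr 1; abel
  rw [e2] at hp
  rw [e1]
  -- triangle inequality through `g₀ (a • x + a • w)`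
  have hg : dist (g₀ (a • x)) (g₀ (a • x + a • w)) = a * ‖w‖ := by
    rw [g₀.dist_map, dist_eq_norm, show a • x - (a • x + a • w) = -(a • w) by abel, norm_neg, norm_smul,
      Real.norm_eq_abs, abs_of_pos hpos]
  calc dist (y j) (g₀ (a • x))
      ≤ dist (y j) (g₀ (a • x + a • w)) + dist (g₀ (a • x + a • w)) (g₀ (a • x)) := dist_triangle _ _ _
    _ = dist (y j) (g₀ (a • x + a • w)) + a * ‖w‖ := by rw [dist_comm (g₀ (a • x + a • w)), hg]
    _ ≤ 23 / 500 * a + a * ((1 / 250 + 3 / 400) * (33 / 10) + 3 / 400 * (33 / 10) ^ 2) := by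
        gcongr
    _ ≤ a / 6 := by nlinarith [budget_le, hpos]


/-! ## Glue (fully proved) -/

/-- **A charge-free site has positive scale.**  If `nn_i = 0` then the bonds of `i` are exactly the
sites coinciding with `y i` (a bond needs `dist ≤ (1+η)·min 0 nn_k = 0`); if there are twelve of
them, any one of them, `k`, has as bond-neighbours the other eleven together with `i`, so the ring
number of `{i, k}` is `11 ≠ 4`.  No sign condition on `η` is needed. -/
theorem nearestDist_pos_of_isChargeFree {N : ℕ} {η : ℝ} {y : Fin N → E3} {i : Fin N}
    (h : IsChargeFree η y i) : 0 < nearestDist y i := by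
  rcases (nearestDist_nonneg y i).eq_or_lt with h0 | hpos
  · exfalso
    -- with `nn_i = 0`, the neighbours of `i` are the sites at distance `0`
    have hN : ∀ k, k ∈ (bondGraph η y).neighborSet i ↔ k ≠ i ∧ dist (y i) (y k) = 0 := by
      intro k
      rw [mem_neighborSet_bondGraph, ← h0]
      constructor
      · rintro ⟨hne, hle⟩
        refine ⟨fun h => hne h.symm, le_antisymm (hle.trans ?_) dist_nonneg⟩
        have : min (0 : ℝ) (nearestDist y k) = 0 := min_eq_left (nearestDist_nonneg y k)
        rw [this, mul_zero]
      · rintro ⟨hne, hd⟩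
        refine ⟨fun h => hne h.symm, ?_⟩
        have : min (0 : ℝ) (nearestDist y k) = 0 := min_eq_left (nearestDist_nonneg y k)
        rw [hd, this, mul_zero]
    have hcard := h.1
    -- pick a neighbour `k`
    obtain ⟨k, hk⟩ : ((bondGraph η y).neighborSet i).Nonempty :=
      Set.nonempty_of_ncard_ne_zero (by rw [hcard]; decide)
    obtain ⟨hki, hdk⟩ := (hN k).1 hk
    -- `nn_k = 0` as well
    have hk0 : nearestDist y k = 0 := by
      refine le_antisymm ?_ (nearestDist_nonneg y k)
      have := nearestDist_le_dist y (j := k) (k := i) (fun h => hki h.symm)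
      rwa [dist_comm, hdk] at this
    have hNk : ∀ m, m ∈ (bondGraph η y).neighborSet k ↔ m ≠ k ∧ dist (y k) (y m) = 0 := by
      intro m
      rw [mem_neighborSet_bondGraph, hk0]
      constructor
      · rintro ⟨hne, hle⟩
        refine ⟨fun h => hne h.symm, le_antisymm (hle.trans ?_) dist_nonneg⟩
        have : min (0 : ℝ) (nearestDist y m) = 0 := min_eq_left (nearestDist_nonneg y m)
        rw [this, mul_zero]
      · rintro ⟨hne, hd⟩
        refine ⟨fun h => hne h.symm, ?_⟩
        have : min (0 : ℝ) (nearestDist y m) = 0 := min_eq_left (nearestDist_nonneg y m)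
        rw [hd, this, mul_zero]
    -- the common neighbours of `i` and `k` are `N(i) \ {k}`
    have hinter : (bondGraph η y).neighborSet i ∩ (bondGraph η y).neighborSet k =
        (bondGraph η y).neighborSet i \ {k} := by
      ext m
      simp only [Set.mem_inter_iff, Set.mem_sdiff, Set.mem_singleton_iff, hN, hNk]
      constructor
      · rintro ⟨⟨hmi, hdm⟩, hmk, -⟩
        exact ⟨⟨hmi, hdm⟩, hmk⟩
      · rintro ⟨⟨hmi, hdm⟩, hmk⟩
        refine ⟨⟨hmi, hdm⟩, hmk, ?_⟩
        have h1 : dist (y k) (y m) ≤ dist (y k) (y i) + dist (y i) (y m) := dist_triangle _ _ _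
        rw [dist_comm (y k) (y i), hdk, hdm, zero_add] at h1
        exact le_antisymm h1 dist_nonneg
    have hring := h.2 k hk
    rw [ringNumber_def, hinter, Set.ncard_sdiff_singleton_of_mem hk, hcard] at hring
    omega
  · exact hpos

/-- The lattice vectors scale linearly in the spacing. -/
theorem triangularVec₁_eq_smul (a : ℝ) : triangularVec₁ a = a • triangularVec₁ 1 := by
  ext l; fin_cases l <;> simp [triangularVec₁]

/-- The lattice vectors scale linearly in the spacing. -/
theorem triangularVec₂_eq_smul (a : ℝ) : triangularVec₂ a = a • triangularVec₂ 1 := by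
  ext l; fin_cases l <;> simp [triangularVec₂] <;> ring

/-- The offset scales linearly in the spacing. -/
theorem barlowOffset_eq_smul (a : ℝ) : barlowOffset a = a • barlowOffset 1 := by
  ext l; fin_cases l <;> simp [barlowOffset] <;> ring

/-- The layer normal scales linearly in the spacing. -/
theorem layerNormal_eq_smul (a c : ℝ) : layerNormal (a * c) = a • layerNormal c := by
  ext l; fin_cases l <;> simp [layerNormal]

/-- **Barlow stackings scale**: `barlowPos a (a c) s = a • barlowPos 1 c s`. -/
theorem barlowPos_eq_smul (a c : ℝ) (s : ℤ → ℤ) (k i j : ℤ) :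
    barlowPos a (a * c) s k i j = a • barlowPos 1 c s k i j := by
  simp only [barlowPos, triangularVec₁_eq_smul a, triangularVec₂_eq_smul a, barlowOffset_eq_smul a,
    layerNormal_eq_smul a c, smul_add, smul_comm _ a]

/-- **Scaling a unit Barlow stacking by `a` gives the stacking of spacing `a`.** -/
theorem smul_mem_barlowStacking {a c : ℝ} {s : ℤ → ℤ} {x : E3}
    (hx : x ∈ barlowStacking 1 c s) : a • x ∈ barlowStacking a (a * c) s := by
  obtain ⟨k, i, j, rfl⟩ := hx
  exact ⟨k, i, j, (barlowPos_eq_smul a c s k i j).symm⟩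

/-- **Conversely**, every point of the stacking of spacing `a` is `a •` a point of the unit
stacking. -/
theorem exists_eq_smul_of_mem_barlowStacking {a c : ℝ} {s : ℤ → ℤ} {z : E3}
    (hz : z ∈ barlowStacking a (a * c) s) : ∃ x ∈ barlowStacking 1 c s, z = a • x := by
  obtain ⟨k, i, j, rfl⟩ := hz
  exact ⟨barlowPos 1 c s k i j, ⟨k, i, j, rfl⟩, barlowPos_eq_smul a c s k i j⟩


/-! ## Composition (no `sorry` below this line) -/

/-- **The line closes the crux (`moebius-split`; composition = v7's with the licence supplied by
`licence_of_ca ∘ stub_caProximity`).**  Charts at every charge-free site of the `8·nn_i`-ball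
(`stub_chartAssembly` fed with `stub_softLink`, `stub_linkEdges`); the exact development `D` on the graph
`5`-ball (`stub_develop`, landed); ONE stacking on the shadow `33/10`-ball with surjectivity and injectivity
(`stub_oneStackingMap`); the real `3·nn_i`-ball inside it (`stub_realBall`); the rigid motion `g`
(`licence_of_ca` from `stub_caProximity`); then the two-way `nn_i/6`-matching by rescaling the unit stacking to spacing `nn_i`. -/
theorem SoftLayerPropagation_of :
    Summit.AtomisticToContinuum.Crystallization.Theses.PricedLinkCensus.SoftLayerPropagation := by
  unfold Summit.AtomisticToContinuum.Crystallization.Theses.PricedLinkCensus.SoftLayerPropagation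
  intro η hη hη1 N y i hcf
  -- the centre is charge-free, hence has positive scale
  have hci : IsChargeFree η y i := hcf i (by
    rw [dist_self]; exact mul_nonneg (by norm_num) (nearestDist_nonneg y i))
  have hpos : 0 < nearestDist y i := nearestDist_pos_of_isChargeFree hci
  -- charts at every site of the hypothesis ball
  have charts := fun (j : Fin N) (hj : dist (y i) (y j) ≤ 8 * nearestDist y i) =>
    stub_chartAssembly stub_softLink stub_linkEdges η hη hη1 N y j (hcf j hj)
      (nearestDist_pos_of_isChargeFree (hcf j hj))
  -- the shadow crystal: development, one stacking, the real ball, the rigid motion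
  obtain ⟨D, hD⟩ := stub_develop η hη hη1 N y i hpos hcf charts
  obtain ⟨s, φ, hs, hmem, hsurj, hinj⟩ := stub_oneStackingMap η hη hη1 N y i hpos hcf D hD
  have hreal := stub_realBall η hη hη1 N y i hpos hcf D φ s hD hs hmem hsurj hinj
  obtain ⟨g, hg⟩ := licence_of_ca hpos (stub_caProximity η hη hη1 N y i hpos hcf D φ s hD hs hmem hsurj hinj)
  refine ⟨s, g, hs, ?_, ?_⟩
  · -- every site of the `3·nn_i`-ball is within `nn_i/6` of the rescaled shadow point
    intro j hj
    obtain ⟨hw, hd⟩ := hreal j hj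
    exact ⟨nearestDist y i • φ (D j), smul_mem_barlowStacking (hmem j hw hd), hg j hw hd⟩
  · -- every stacking point of the `3·nn_i`-ball is within `nn_i/6` of a site
    intro z hz hzi
    obtain ⟨x, hx, rfl⟩ := exists_eq_smul_of_mem_barlowStacking hz
    -- the centre itself is matched, so `x` is within `19/6` of `φ (D i)`
    have hwi : ∃ w : (bondGraph η y).Walk i i, w.length ≤ 5 := ⟨SimpleGraph.Walk.nil, by simp⟩
    have hdi : dist (D i) (D i) ≤ 33 / 10 := by rw [dist_self]; norm_num
    have hgi := hg i hwi hdi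
    have hdist : dist (nearestDist y i • x) (nearestDist y i • φ (D i)) =
        nearestDist y i * dist x (φ (D i)) := by
      rw [dist_smul₀, Real.norm_eq_abs, abs_of_pos hpos]
    have hx13 : dist x (φ (D i)) ≤ 33 / 10 := by
      have h1 : dist (g (nearestDist y i • x)) (g (nearestDist y i • φ (D i))) ≤
          dist (g (nearestDist y i • x)) (y i) + dist (y i) (g (nearestDist y i • φ (D i))) :=
        dist_triangle _ _ _
      rw [AffineIsometryEquiv.dist_map, hdist, dist_comm (g (nearestDist y i • x)) (y i)] at h1
      have h3 : nearestDist y i * dist x (φ (D i)) ≤ nearestDist y i * (19 / 6) := by linarith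
      have h4 : dist x (φ (D i)) ≤ 19 / 6 := le_of_mul_le_mul_left h3 hpos
      linarith
    obtain ⟨j, hw, hd, hjx⟩ := hsurj x hx hx13
    refine ⟨j, ?_⟩
    have := hg j hw hd
    rwa [hjx] at this

end Summit.AtomisticToContinuum.Crystallization.Cruxes.SoftLayerPropagation.MoebiusSplit

end
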